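import Summits.QuantumFields.YangMills.Theorems.BalabanUVNodesN15KingModelFullPropagatorOperatorHolderRate
import Literature.MathematicalPhysics.QuantumFieldTheory.King1986.SlicePropagatorStatements
import HarnessLib

/-!
# BalabanUVNodes ∕ N15 — THE KING-MODEL RUNG, CURVED EDITION (PART Χ-c₁): THE INTERPOLATION LEMMA BEHIND KING's (3.75) — a two-spacing rate for
# HÖLDER QUOTIENTS `(∂_α(x′, y′)F′)(z′) − (∂_α(x, y)F)(z)` from the two-spacing SUP rate of `F′ − F∘pt` and the one-spacing Hölder letters of `F′`, `F`
# at a larger exponent `α′`, plus the pairing defect `||x′ − y′| − |x − y|| ≤ η` (pure real analysis on abstract carriers; no King object)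
# (Track A, DAG node N15 = NE2; FAN-OUT v1.1 §N15 s3 «KING-MODEL RUNG»)

HONEST FRAMING.  Count-neutral (cell `pub-ymgap`, seat `pub-ymgap-dag-n15-e` g18; `--supports stmt-QuantumFields-27366 --as helper` = K3⁸
`SpineGivenEndpointR13SepCoPHV`).  TEMPLATE-LITERATURE TOOLING for [King1986] Prop. 3.9 (3.75) p. 665 («0 < α < 1, and γ sufficiently small») at `A = 0`
(part Χ-c₂ instantiates it on the datum `kingSlicesTwoSpacing`); NOT King's own argument ((4.43) p. 675 replaces the three factors in Hölder norms) but an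
elementary interpolation giving the printed SHAPE with King's quantifier order; NOT Bałaban's covariant objects; NE2⁺ is NOT PRINTED for those and not
proved; NOT a node discharge; nothing continuum ∕ ℝ⁴ ∕ OS ∕ mass-gap ∕ Clay.  0 `sorry`, 0 `def`; standard axioms.

CONTENT.  §1 `rpow_neg_sub_rpow_neg_le` (`m^{−α} − M^{−α} ≤ m^{−α}(M − m)∕M`, `0 < m ≤ M`, `α ≤ 1`), `abs_rpow_neg_sub_mul_le` (the pairing-defect term costs
`H·η^{α′−α}`), ★ `twoSpacing_holderQuot_le`: for `0 < α < α′ ≤ 1`, `a > 0`, `b ≥ η > 0`, `|a − b| ≤ η`, letters `|P − p|, |Q − q| ≤ R`, `|P − Q| ≤ Ha^{α′}`,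
`|p − q| ≤ Hb^{α′}` ⟹ `|a^{−α}(P − Q) − b^{−α}(p − q)| ≤ (2R)^{1−α∕α′}(3H)^{α∕α′} + 3Hη^{α′−α}` (case `a ≤ η`: each quotient separately; case `a > η`: the
main term by `le_interpolate_rpow` (part T-e) between `2R` and `3Ha^{α′}`, the defect term by §1), `interpolated_letter_eq`∕`defect_letter_eq` (bookkeeping
of the constants when `R = C₁s^eρW`, `H = C₂s^{e−α′}W`: the bound is `[(2C₁)^{1−α∕α′}(3C₂)^{α∕α′}ρ^{1−α∕α′} + 3C₂(η∕s)^{α′−α}]·s^{e−α}·W`), ★★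
`twoSpacing_holderLine`: the abstract-carrier form of (3.75) — from a sup two-spacing letter with rate `ρ` and weight `e^{−δ₁s^{−1}d(pt u, pt z)}`, Hölder
letters with weight `e^{−δ₂s^{−1}min}` on both carriers, distances moved by the pairing by at most `η ≤ 1` and coarse distances `≥ η` when positive, to the
Hölder-quotient two-spacing bound with weight `e^{−min(δ₁,δ₂)·min(d(x,z), d(y,z))}` (no `s^{−1}` — as printed in (3.75)).
WHY «γ AFTER α»: the interpolated rate is `ρ^{1−α∕α′}` and the defect rate is `(η∕s)^{α′−α}`; both exponents vanish as `α ↑ α′ ≤ 1`.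
Locators: [King1986] (3.62) p.663, Prop. 3.9 (3.75) p.665, (4.43) p.675.
-/

noncomputable section

namespace Summit.QuantumFields.YangMills.BalabanUVNodes.N15KingModelRung.Curved

open Real
open Literature.MathematicalPhysics.QuantumFieldTheory.King1986.SlicePropagator (holderDeriv holderDeriv_def abs_holderDeriv_le_iff)

/-! ## §1 The interpolation lemma: a two-spacing HÖLDER-quotient rate from a sup two-spacing rate and one-spacing Hölder letters -/

section Generic

/-- For `0 < m ≤ M` and `α ≤ 1`: `m^{−α} − M^{−α} ≤ m^{−α}·(M − m)∕M` (since `(m∕M)^α ≥ m∕M`). [folklore] -/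
theorem rpow_neg_sub_rpow_neg_le {m M α : ℝ} (hm : 0 < m) (hmM : m ≤ M) (hα1 : α ≤ 1) :
    m ^ (-α) - M ^ (-α) ≤ m ^ (-α) * ((M - m) / M) := by
  have hM : 0 < M := hm.trans_le hmM
  have hq0 : 0 < m / M := div_pos hm hM
  have hq1 : m / M ≤ 1 := (div_le_one hM).mpr hmM
  -- `(m/M)^α ≥ (m/M)^1`
  have hq : m / M ≤ (m / M) ^ α := by
    have := Real.rpow_le_rpow_of_exponent_ge hq0 hq1 hα1
    rwa [Real.rpow_one] at this
  -- `M^{−α} = m^{−α}·(m/M)^α`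
  have hMm : M ^ (-α) = m ^ (-α) * (m / M) ^ α := by
    rw [Real.div_rpow hm.le hM.le, Real.rpow_neg hm.le, Real.rpow_neg hM.le]
    field_simp
  have hmα : 0 ≤ m ^ (-α) := Real.rpow_nonneg hm.le _
  rw [hMm]
  have : m ^ (-α) * ((M - m) / M) = m ^ (-α) - m ^ (-α) * (m / M) := by field_simp
  rw [this]
  exact sub_le_sub_left (mul_le_mul_of_nonneg_left hq hmα) _

/-- `|a^{−α} − b^{−α}|·|p − q| ≤ H·η^{α′−α}` when `|p − q| ≤ H·b^{α′}`, `η ≤ a`, `η ≤ b`, `|a − b| ≤ η`, `0 < α < α′ ≤ 1` — the pairing-defect term of the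
two-spacing Hölder quotient costs one coarse spacing to the power `α′ − α`. [cite: King1986, Prop. 3.9 (3.75) p.665, (4.43) p.675] -/
theorem abs_rpow_neg_sub_mul_le {a b η α α' H p q : ℝ} (hα : 0 < α) (hαα' : α < α') (hα'1 : α' ≤ 1) (hη : 0 < η) (ha : η ≤ a) (hb : η ≤ b)
    (hab : |a - b| ≤ η) (hH : 0 ≤ H) (h4 : |p - q| ≤ H * b ^ α') :
    |a ^ (-α) - b ^ (-α)| * |p - q| ≤ H * η ^ (α' - α) := by
  have ha0 : 0 < a := hη.trans_le ha
  have hb0 : 0 < b := hη.trans_le hb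
  -- the key power estimate: for `η ≤ m ≤ M`, `|a − b| = M − m`, `m^{−α}(η/M)·(H M^{α′}) ≤ H η^{α′−α}`
  have key : ∀ {m M : ℝ}, η ≤ m → m ≤ M → M - m ≤ η →
      m ^ (-α) * ((M - m) / M) * (H * M ^ α') ≤ H * η ^ (α' - α) := by
    intro m M hηm hmM hMm
    have hm : 0 < m := hη.trans_le hηm
    have hM : 0 < M := hm.trans_le hmM
    have hmα : 0 ≤ m ^ (-α) := Real.rpow_nonneg hm.le _
    -- `M^{α′} / M = M^{α′−1} ≤ m^{α′−1}`
    have h1 : M ^ α' / M = M ^ (α' - 1) := by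
      rw [Real.rpow_sub hM, Real.rpow_one]
    have h2 : M ^ (α' - 1) ≤ m ^ (α' - 1) := Real.rpow_le_rpow_of_nonpos hm hmM (by linarith)
    -- `m^{−α}·m^{α′−1} = m^{α′−α−1} ≤ η^{α′−α−1}`
    have h3 : m ^ (-α) * m ^ (α' - 1) = m ^ (α' - α - 1) := by
      rw [← Real.rpow_add hm]; ring_nf
    have h4' : m ^ (α' - α - 1) ≤ η ^ (α' - α - 1) := Real.rpow_le_rpow_of_nonpos hη hηm (by linarith)
    have h5 : η * η ^ (α' - α - 1) = η ^ (α' - α) := by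
      rw [← Real.rpow_one_add' hη.le (by linarith)]; ring_nf
    calc m ^ (-α) * ((M - m) / M) * (H * M ^ α')
        = H * (M - m) * (m ^ (-α) * (M ^ α' / M)) := by ring
      _ ≤ H * η * (m ^ (-α) * m ^ (α' - 1)) := by
          rw [h1]
          exact mul_le_mul (mul_le_mul_of_nonneg_left hMm hH) (mul_le_mul_of_nonneg_left h2 hmα)
            (mul_nonneg hmα (Real.rpow_nonneg hM.le _)) (mul_nonneg hH hη.le)
      _ = H * (η * m ^ (α' - α - 1)) := by rw [h3]; ring
      _ ≤ H * (η * η ^ (α' - α - 1)) := mul_le_mul_of_nonneg_left (mul_le_mul_of_nonneg_left h4' hη.le) hH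
      _ = H * η ^ (α' - α) := by rw [h5]
  rcases le_total a b with hle | hle
  · -- `a ≤ b`: `0 ≤ a^{−α} − b^{−α} ≤ a^{−α}(b − a)/b`, `|p − q| ≤ H b^{α′}`
    have hd : 0 ≤ a ^ (-α) - b ^ (-α) := sub_nonneg.mpr (Real.rpow_le_rpow_of_nonpos ha0 hle (by linarith))
    have hba : b - a ≤ η := by rw [abs_sub_comm] at hab; exact (le_abs_self _).trans hab
    rw [abs_of_nonneg hd]
    calc (a ^ (-α) - b ^ (-α)) * |p - q| ≤ a ^ (-α) * ((b - a) / b) * (H * b ^ α') :=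
          mul_le_mul (rpow_neg_sub_rpow_neg_le ha0 hle (by linarith)) h4 (abs_nonneg _)
            (mul_nonneg (Real.rpow_nonneg ha0.le _) (div_nonneg (by linarith) hb0.le))
      _ ≤ H * η ^ (α' - α) := key ha hle hba
  · -- `b ≤ a`: `0 ≤ b^{−α} − a^{−α} ≤ b^{−α}(a − b)/a`, `|p − q| ≤ H b^{α′} ≤ H a^{α′}`
    have hd : 0 ≤ b ^ (-α) - a ^ (-α) := sub_nonneg.mpr (Real.rpow_le_rpow_of_nonpos hb0 hle (by linarith))
    have hab' : a - b ≤ η := (le_abs_self _).trans hab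
    have h4a : |p - q| ≤ H * a ^ α' := h4.trans (mul_le_mul_of_nonneg_left (Real.rpow_le_rpow hb0.le hle (by linarith)) hH)
    rw [abs_sub_comm, abs_of_nonneg hd]
    calc (b ^ (-α) - a ^ (-α)) * |p - q| ≤ b ^ (-α) * ((a - b) / a) * (H * a ^ α') :=
          mul_le_mul (rpow_neg_sub_rpow_neg_le hb0 hle (by linarith)) h4a (abs_nonneg _)
            (mul_nonneg (Real.rpow_nonneg hb0.le _) (div_nonneg (by linarith) ha0.le))
      _ ≤ H * η ^ (α' - α) := key hb hle hab'

/-- ★ **THE INTERPOLATION LEMMA** (pure real analysis). Let `0 < α < α′ ≤ 1`; two "distances" `a > 0` (fine) and `b ≥ η > 0` (coarse) with the pairing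
defect `|a − b| ≤ η`; four values `P = F′(x′), Q = F′(y′), p = F(x), q = F(y)` with the TWO-SPACING SUP letters `|P − p|, |Q − q| ≤ R` and the
ONE-SPACING HÖLDER letters `|P − Q| ≤ H·a^{α′}`, `|p − q| ≤ H·b^{α′}`.  Then the two-spacing difference of the HÖLDER QUOTIENTS obeys
`|a^{−α}(P − Q) − b^{−α}(p − q)| ≤ (2R)^{1−α∕α′}·(3H)^{α∕α′} + 3H·η^{α′−α}` — a rate `R^{1−α∕α′}` interpolated between the sup rate and the Hölder size,
plus the pairing defect `η^{α′−α}`; this is how «γ sufficiently small, given α» arises. [cite: King1986, Prop. 3.9 (3.75) p.665 («0 < α < 1, and γ sufficiently small»), (4.43) p.675] -/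
theorem twoSpacing_holderQuot_le {α α' a b η R H P Q p q : ℝ} (hα : 0 < α) (hαα' : α < α') (hα'1 : α' ≤ 1)
    (ha : 0 < a) (hη : 0 < η) (hb : η ≤ b) (hab : |a - b| ≤ η) (hR : 0 ≤ R) (hH : 0 ≤ H)
    (h1 : |P - p| ≤ R) (h2 : |Q - q| ≤ R) (h3 : |P - Q| ≤ H * a ^ α') (h4 : |p - q| ≤ H * b ^ α') :
    |a ^ (-α) * (P - Q) - b ^ (-α) * (p - q)| ≤ (2 * R) ^ (1 - α / α') * (3 * H) ^ (α / α') + 3 * H * η ^ (α' - α) := by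
  have hα' : 0 < α' := hα.trans hαα'
  have hb0 : 0 < b := hη.trans_le hb
  have hθ0 : 0 ≤ α / α' := div_nonneg hα.le hα'.le
  have hθ1 : α / α' ≤ 1 := (div_le_one hα').mpr hαα'.le
  have hε : 0 < α' - α := by linarith
  have haα : 0 ≤ a ^ (-α) := Real.rpow_nonneg ha.le _
  have hbα : 0 ≤ b ^ (-α) := Real.rpow_nonneg hb0.le _
  have hI0 : 0 ≤ (2 * R) ^ (1 - α / α') * (3 * H) ^ (α / α') :=
    mul_nonneg (Real.rpow_nonneg (by linarith) _) (Real.rpow_nonneg (by linarith) _)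
  have hηpow : 0 ≤ η ^ (α' - α) := Real.rpow_nonneg hη.le _
  rcases le_or_gt a η with haη | haη
  · -- CASE `a ≤ η`: each quotient separately (no two-spacing input)
    have hbη : b ≤ 2 * η := by
      have h := hab
      rw [abs_sub_comm] at h
      have := (le_abs_self (b - a)).trans h
      linarith
    -- `|a^{−α}(P−Q)| ≤ H a^{α′−α} ≤ H η^{α′−α}`
    have hA : |a ^ (-α) * (P - Q)| ≤ H * η ^ (α' - α) := by
      rw [abs_mul, abs_of_nonneg haα]
      calc a ^ (-α) * |P - Q| ≤ a ^ (-α) * (H * a ^ α') := mul_le_mul_of_nonneg_left h3 haα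
        _ = H * (a ^ (-α) * a ^ α') := by ring
        _ = H * a ^ (α' - α) := by rw [← Real.rpow_add ha]; try ring_nf
        _ ≤ H * η ^ (α' - α) := mul_le_mul_of_nonneg_left (Real.rpow_le_rpow ha.le haη hε.le) hH
    -- `|b^{−α}(p−q)| ≤ H b^{α′−α} ≤ H (2η)^{α′−α} ≤ 2H η^{α′−α}`
    have hB : |b ^ (-α) * (p - q)| ≤ 2 * H * η ^ (α' - α) := by
      rw [abs_mul, abs_of_nonneg hbα]
      have h2pow : (2 * η) ^ (α' - α) ≤ 2 * η ^ (α' - α) := by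
        rw [Real.mul_rpow (by norm_num) hη.le]
        refine mul_le_mul_of_nonneg_right ?_ hηpow
        calc (2 : ℝ) ^ (α' - α) ≤ (2 : ℝ) ^ (1 : ℝ) := Real.rpow_le_rpow_of_exponent_le one_le_two (by linarith)
          _ = 2 := Real.rpow_one 2
      calc b ^ (-α) * |p - q| ≤ b ^ (-α) * (H * b ^ α') := mul_le_mul_of_nonneg_left h4 hbα
        _ = H * (b ^ (-α) * b ^ α') := by ring
        _ = H * b ^ (α' - α) := by rw [← Real.rpow_add hb0]; try ring_nf
        _ ≤ H * (2 * η) ^ (α' - α) := mul_le_mul_of_nonneg_left (Real.rpow_le_rpow hb0.le hbη hε.le) hH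
        _ ≤ H * (2 * η ^ (α' - α)) := mul_le_mul_of_nonneg_left h2pow hH
        _ = 2 * H * η ^ (α' - α) := by ring
    calc |a ^ (-α) * (P - Q) - b ^ (-α) * (p - q)| ≤ |a ^ (-α) * (P - Q)| + |b ^ (-α) * (p - q)| := abs_sub _ _
      _ ≤ H * η ^ (α' - α) + 2 * H * η ^ (α' - α) := add_le_add hA hB
      _ = 3 * H * η ^ (α' - α) := by ring
      _ ≤ (2 * R) ^ (1 - α / α') * (3 * H) ^ (α / α') + 3 * H * η ^ (α' - α) := le_add_of_nonneg_left hI0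
  · -- CASE `a > η`: interpolate the main term, the defect term by `abs_rpow_neg_sub_mul_le`
    have hba : b ≤ 2 * a := by
      have h := hab
      rw [abs_sub_comm] at h
      have := (le_abs_self (b - a)).trans h
      linarith
    have hsplit : a ^ (-α) * (P - Q) - b ^ (-α) * (p - q)
        = a ^ (-α) * ((P - p) - (Q - q)) + (a ^ (-α) - b ^ (-α)) * (p - q) := by ring
    -- the main term: `X := |(P−p) − (Q−q)| ≤ 2R` and `≤ 3H a^{α′}`
    have hX1 : |(P - p) - (Q - q)| ≤ 1 * (2 * R) := by
      rw [one_mul]; exact (abs_sub _ _).trans (by linarith)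
    have h2a : (2 * a) ^ α' ≤ 2 * a ^ α' := by
      rw [Real.mul_rpow (by norm_num) ha.le]
      refine mul_le_mul_of_nonneg_right ?_ (Real.rpow_nonneg ha.le _)
      calc (2 : ℝ) ^ α' ≤ (2 : ℝ) ^ (1 : ℝ) := Real.rpow_le_rpow_of_exponent_le one_le_two hα'1
        _ = 2 := Real.rpow_one 2
    have hX2 : |(P - p) - (Q - q)| ≤ 1 * (3 * H * a ^ α') := by
      rw [one_mul]
      have e1 : (P - p) - (Q - q) = (P - Q) - (p - q) := by ring
      rw [e1]
      calc |(P - Q) - (p - q)| ≤ |P - Q| + |p - q| := abs_sub _ _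
        _ ≤ H * a ^ α' + H * b ^ α' := add_le_add h3 h4
        _ ≤ H * a ^ α' + H * (2 * a) ^ α' :=
            add_le_add le_rfl (mul_le_mul_of_nonneg_left (Real.rpow_le_rpow hb0.le hba hα'.le) hH)
        _ ≤ H * a ^ α' + H * (2 * a ^ α') := add_le_add le_rfl (mul_le_mul_of_nonneg_left h2a hH)
        _ = 3 * H * a ^ α' := by ring
    have hX := le_interpolate_rpow zero_le_one (by linarith : 0 ≤ 2 * R) (by positivity : 0 ≤ 3 * H * a ^ α')
      hθ0 hθ1 hX1 hX2
    -- `(3H a^{α′})^{α/α′} = (3H)^{α/α′}·a^{α}`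
    have hpow : (3 * H * a ^ α') ^ (α / α') = (3 * H) ^ (α / α') * a ^ α := by
      rw [Real.mul_rpow (by linarith) (Real.rpow_nonneg ha.le _), ← Real.rpow_mul ha.le]
      congr 2
      field_simp
    have hmain : |a ^ (-α) * ((P - p) - (Q - q))| ≤ (2 * R) ^ (1 - α / α') * (3 * H) ^ (α / α') := by
      rw [abs_mul, abs_of_nonneg haα]
      calc a ^ (-α) * |(P - p) - (Q - q)| ≤ a ^ (-α) * (1 * (2 * R) ^ (1 - α / α') * (3 * H * a ^ α') ^ (α / α')) :=
            mul_le_mul_of_nonneg_left hX haα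
        _ = (2 * R) ^ (1 - α / α') * (3 * H) ^ (α / α') * (a ^ (-α) * a ^ α) := by rw [hpow]; ring
        _ = (2 * R) ^ (1 - α / α') * (3 * H) ^ (α / α') := by
            rw [Real.rpow_neg ha.le, inv_mul_cancel₀ (Real.rpow_pos_of_pos ha α).ne', mul_one]
    have hdef : |(a ^ (-α) - b ^ (-α)) * (p - q)| ≤ H * η ^ (α' - α) := by
      rw [abs_mul]
      exact abs_rpow_neg_sub_mul_le hα hαα' hα'1 hη haη.le hb hab hH h4
    rw [hsplit]
    calc |a ^ (-α) * ((P - p) - (Q - q)) + (a ^ (-α) - b ^ (-α)) * (p - q)|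
        ≤ |a ^ (-α) * ((P - p) - (Q - q))| + |(a ^ (-α) - b ^ (-α)) * (p - q)| := abs_add_le _ _
      _ ≤ (2 * R) ^ (1 - α / α') * (3 * H) ^ (α / α') + H * η ^ (α' - α) := add_le_add hmain hdef
      _ ≤ (2 * R) ^ (1 - α / α') * (3 * H) ^ (α / α') + 3 * H * η ^ (α' - α) := by
          nlinarith [mul_nonneg hH hηpow]

/-- **Bookkeeping for the interpolated constant**: with `R = C₁·s^e·ρ·W` (sup rate letter: size `s^e`, rate `ρ`, weight `W`) and `H = C₂·s^{e−α′}·W`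
(Hölder letter), `θ + β = 1`, `α′β = α`, all bases positive: `(2R)^θ·(3H)^β = (2C₁)^θ(3C₂)^β · s^{e−α} · ρ^θ · W`. [folklore] -/
theorem interpolated_letter_eq {C₁ C₂ s ρ W e α α' θ β : ℝ} (hC₁ : 0 < C₁) (hC₂ : 0 < C₂) (hs : 0 < s) (hρ : 0 < ρ) (hW : 0 < W)
    (hθβ : θ + β = 1) (hαβ : α' * β = α) :
    (2 * (C₁ * s ^ e * ρ * W)) ^ θ * (3 * (C₂ * s ^ (e - α') * W)) ^ β
      = (2 * C₁) ^ θ * (3 * C₂) ^ β * s ^ (e - α) * ρ ^ θ * W := by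
  have hse : 0 < s ^ e := Real.rpow_pos_of_pos hs _
  have hse' : 0 < s ^ (e - α') := Real.rpow_pos_of_pos hs _
  have h2 : (0 : ℝ) < 2 * C₁ := by positivity
  have h3 : (0 : ℝ) < 3 * C₂ := by positivity
  have hA : 0 < 2 * (C₁ * s ^ e * ρ * W) := by positivity
  have hB : 0 < 3 * (C₂ * s ^ (e - α') * W) := by positivity
  have lA : Real.log (2 * (C₁ * s ^ e * ρ * W)) = Real.log (2 * C₁) + e * Real.log s + Real.log ρ + Real.log W := by
    rw [show 2 * (C₁ * s ^ e * ρ * W) = (2 * C₁) * s ^ e * ρ * W by ring,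
      Real.log_mul (by positivity) hW.ne', Real.log_mul (by positivity) hρ.ne', Real.log_mul h2.ne' hse.ne', Real.log_rpow hs]
  have lB : Real.log (3 * (C₂ * s ^ (e - α') * W)) = Real.log (3 * C₂) + (e - α') * Real.log s + Real.log W := by
    rw [show 3 * (C₂ * s ^ (e - α') * W) = (3 * C₂) * s ^ (e - α') * W by ring,
      Real.log_mul (by positivity) hW.ne', Real.log_mul h3.ne' hse'.ne', Real.log_rpow hs]
  rw [Real.rpow_def_of_pos hA, Real.rpow_def_of_pos hB, lA, lB, Real.rpow_def_of_pos h2, Real.rpow_def_of_pos h3,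
    Real.rpow_def_of_pos hρ, Real.rpow_def_of_pos hs]
  conv_rhs => rw [← Real.exp_log hW]
  simp only [← Real.exp_add]
  congr 1
  have hβ : β = 1 - θ := by linarith
  subst hβ
  have hα : α = α' * (1 - θ) := hαβ.symm
  subst hα
  ring

/-- **The defect letter**: `3H·η^{α′−α}` with `H = C₂·s^{e−α′}·W` equals `3C₂·s^{e−α}·(η∕s)^{α′−α}·W` (`s, η > 0`). [folklore] -/
theorem defect_letter_eq {C₂ s η W e α α' : ℝ} (hs : 0 < s) (hη : 0 < η) :
    3 * (C₂ * s ^ (e - α') * W) * η ^ (α' - α) = 3 * C₂ * s ^ (e - α) * (η / s) ^ (α' - α) * W := by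
  have h1 : s ^ (e - α') = s ^ (e - α) * s ^ (-(α' - α)) := by
    rw [← Real.rpow_add hs]; ring_nf
  have h2 : s ^ (-(α' - α)) * η ^ (α' - α) = (η / s) ^ (α' - α) := by
    rw [Real.div_rpow hη.le hs.le, Real.rpow_neg hs.le, div_eq_mul_inv, mul_comm]
  rw [h1, ← h2]; ring

/-- ★★ **THE TWO-SPACING HÖLDER LINE FROM LETTERS** (abstract carrier version of (3.75)).  Data: fine∕coarse "sites" with distances `dhi`, `dlo ≥ 0`, a pairing
`pt` moving distances by at most `η ≤ 1` either way, coarse distances `≥ η` when positive; kernels `Fhi`, `Flo`; a slice length `0 < s ≤ 1`.  Letters: the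
two-spacing SUP letter `|Fhi u z − Flo (pt u) (pt z)| ≤ C₁·ρ·s^e·e^{−δ₁s^{−1}dlo(pt u, pt z)}` (rate `ρ > 0`) and the one-spacing HÖLDER letters at an exponent
`α′ ∈ (α, 1]` for both kernels, `≤ C₂·s^{e−α′}·e^{−δ₂s^{−1}min(d(u,w),d(v,w))}`.  Conclusion: the Hölder quotients at exponent `α` differ by at most
`[(2C₁)^{1−α∕α′}(3C₂e^{δ₂})^{α∕α′}·ρ^{1−α∕α′} + 3C₂e^{δ₂}·(η∕s)^{α′−α}]·s^{e−α}·e^{−min(δ₁,δ₂)·min(dlo(pt x, pt z), dlo(pt y, pt z))}` — §1's interpolation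
lemma with the weights reconciled. [cite: King1986, Prop. 3.9 (3.75) p.665, (4.43) p.675] -/
theorem twoSpacing_holderLine {Shi Slo : Type*} (pt : Shi → Slo) (dhi : Shi → Shi → ℝ) (dlo : Slo → Slo → ℝ)
    (Fhi : Shi → Shi → ℝ) (Flo : Slo → Slo → ℝ) {s η e α α' ρ C₁ C₂ δ₁ δ₂ : ℝ}
    (hα : 0 < α) (hαα' : α < α') (hα'1 : α' ≤ 1) (hs : 0 < s) (hs1 : s ≤ 1) (hη : 0 < η) (hη1 : η ≤ 1) (hρ : 0 < ρ)
    (hC₁ : 0 < C₁) (hC₂ : 0 < C₂) (hδ₁ : 0 < δ₁) (hδ₂ : 0 < δ₂)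
    (hdhi : ∀ u v, 0 ≤ dhi u v) (hdlo : ∀ u v, 0 ≤ dlo u v)
    (hgeo1 : ∀ u v, dlo (pt u) (pt v) ≤ dhi u v + η) (hgeo2 : ∀ u v, dhi u v ≤ dlo (pt u) (pt v) + η)
    (hgeo3 : ∀ u v, 0 < dlo u v → η ≤ dlo u v)
    (hR : ∀ u z, |Fhi u z - Flo (pt u) (pt z)| ≤ C₁ * ρ * s ^ e * Real.exp (-(δ₁ * s⁻¹ * dlo (pt u) (pt z))))
    (hHhi : ∀ u v w, 0 < dhi u v →
      |holderDeriv dhi α' Fhi u v w| ≤ C₂ * s ^ (e - α') * Real.exp (-(δ₂ * s⁻¹ * min (dhi u w) (dhi v w))))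
    (hHlo : ∀ u v w, 0 < dlo u v →
      |holderDeriv dlo α' Flo u v w| ≤ C₂ * s ^ (e - α') * Real.exp (-(δ₂ * s⁻¹ * min (dlo u w) (dlo v w))))
    (x y z : Shi) (hxy : 0 < dhi x y) (hxy' : 0 < dlo (pt x) (pt y)) :
    |holderDeriv dhi α Fhi x y z - holderDeriv dlo α Flo (pt x) (pt y) (pt z)|
      ≤ ((2 * C₁) ^ (1 - α / α') * (3 * (C₂ * Real.exp δ₂)) ^ (α / α') * ρ ^ (1 - α / α')
            + 3 * (C₂ * Real.exp δ₂) * (η / s) ^ (α' - α))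
          * s ^ (e - α) * Real.exp (-(min δ₁ δ₂ * min (dlo (pt x) (pt z)) (dlo (pt y) (pt z)))) := by
  have hα' : 0 < α' := hα.trans hαα'
  set δ₀ : ℝ := min δ₁ δ₂ with hδ₀def
  have hδ₀1 : δ₀ ≤ δ₁ := min_le_left _ _
  have hδ₀2 : δ₀ ≤ δ₂ := min_le_right _ _
  have hδ₀ : 0 < δ₀ := lt_min hδ₁ hδ₂
  set m : ℝ := min (dlo (pt x) (pt z)) (dlo (pt y) (pt z)) with hmdef
  have hm0 : 0 ≤ m := le_min (hdlo _ _) (hdlo _ _)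
  set W : ℝ := Real.exp (-(δ₀ * m)) with hWdef
  have hW : 0 < W := Real.exp_pos _
  have hsinv : 1 ≤ s⁻¹ := (one_le_inv₀ hs).mpr hs1
  -- weight reconciliations
  have hw1 : ∀ {t : ℝ}, m ≤ t → Real.exp (-(δ₁ * s⁻¹ * t)) ≤ W := by
    intro t hmt
    refine Real.exp_le_exp.mpr ?_
    have : δ₀ * m ≤ δ₁ * s⁻¹ * t := by
      calc δ₀ * m ≤ δ₁ * m := mul_le_mul_of_nonneg_right hδ₀1 hm0
        _ = δ₁ * 1 * m := by ring
        _ ≤ δ₁ * s⁻¹ * t := mul_le_mul (mul_le_mul_of_nonneg_left hsinv hδ₁.le) hmt hm0 (by positivity)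
    linarith
  have hw2 : Real.exp (-(δ₂ * s⁻¹ * m)) ≤ W := by
    refine Real.exp_le_exp.mpr ?_
    have : δ₀ * m ≤ δ₂ * s⁻¹ * m := by
      calc δ₀ * m ≤ δ₂ * m := mul_le_mul_of_nonneg_right hδ₀2 hm0
        _ = δ₂ * 1 * m := by ring
        _ ≤ δ₂ * s⁻¹ * m := mul_le_mul_of_nonneg_right (mul_le_mul_of_nonneg_left hsinv hδ₂.le) hm0
    linarith
  have hw3 : Real.exp (-(δ₂ * s⁻¹ * min (dhi x z) (dhi y z))) ≤ Real.exp δ₂ * W := by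
    have hmhi : m - η ≤ min (dhi x z) (dhi y z) := by
      have h1 := hgeo1 x z
      have h2 := hgeo1 y z
      have : m ≤ dlo (pt x) (pt z) := min_le_left _ _
      have : m ≤ dlo (pt y) (pt z) := min_le_right _ _
      exact le_min (by linarith) (by linarith)
    have hmin0 : 0 ≤ min (dhi x z) (dhi y z) := le_min (hdhi _ _) (hdhi _ _)
    rw [hWdef, ← Real.exp_add]
    refine Real.exp_le_exp.mpr ?_
    -- `δ₂ s⁻¹ min_hi ≥ δ₂ min_hi ≥ δ₂ (m − η) ≥ δ₀ m − δ₂ η ≥ δ₀ m − δ₂`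
    have h1 : δ₂ * min (dhi x z) (dhi y z) ≤ δ₂ * s⁻¹ * min (dhi x z) (dhi y z) := by
      calc δ₂ * min (dhi x z) (dhi y z) = δ₂ * 1 * min (dhi x z) (dhi y z) := by ring
        _ ≤ δ₂ * s⁻¹ * min (dhi x z) (dhi y z) := mul_le_mul_of_nonneg_right (mul_le_mul_of_nonneg_left hsinv hδ₂.le) hmin0
    have h2 : δ₀ * m ≤ δ₂ * m := mul_le_mul_of_nonneg_right hδ₀2 hm0
    nlinarith [mul_le_mul_of_nonneg_left hmhi hδ₂.le, mul_le_mul_of_nonneg_left hη1 hδ₂.le]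
  -- the four letters in the currency of §1's interpolation lemma
  set a : ℝ := dhi x y with hadef
  set b : ℝ := dlo (pt x) (pt y) with hbdef
  have hab : |a - b| ≤ η := by
    rw [abs_le]; constructor <;> linarith [hgeo1 x y, hgeo2 x y]
  have hbη : η ≤ b := hgeo3 _ _ hxy'
  set R : ℝ := C₁ * s ^ e * ρ * W with hRdef
  set H : ℝ := (C₂ * Real.exp δ₂) * s ^ (e - α') * W with hHdef
  have hse : 0 < s ^ e := Real.rpow_pos_of_pos hs _
  have hse' : 0 < s ^ (e - α') := Real.rpow_pos_of_pos hs _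
  have hR0 : 0 ≤ R := by positivity
  have hH0 : 0 ≤ H := by positivity
  have hCH : C₂ ≤ C₂ * Real.exp δ₂ := le_mul_of_one_le_right hC₂.le (Real.one_le_exp hδ₂.le)
  have h1 : |Fhi x z - Flo (pt x) (pt z)| ≤ R := by
    refine (hR x z).trans ?_
    rw [hRdef]
    calc C₁ * ρ * s ^ e * Real.exp (-(δ₁ * s⁻¹ * dlo (pt x) (pt z))) ≤ C₁ * ρ * s ^ e * W :=
          mul_le_mul_of_nonneg_left (hw1 (min_le_left _ _)) (by positivity)
      _ = C₁ * s ^ e * ρ * W := by ring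
  have h2 : |Fhi y z - Flo (pt y) (pt z)| ≤ R := by
    refine (hR y z).trans ?_
    rw [hRdef]
    calc C₁ * ρ * s ^ e * Real.exp (-(δ₁ * s⁻¹ * dlo (pt y) (pt z))) ≤ C₁ * ρ * s ^ e * W :=
          mul_le_mul_of_nonneg_left (hw1 (min_le_right _ _)) (by positivity)
      _ = C₁ * s ^ e * ρ * W := by ring
  have h3 : |Fhi x z - Fhi y z| ≤ H * a ^ α' := by
    have h := hHhi x y z hxy
    rw [abs_holderDeriv_le_iff α' Fhi hxy z] at h
    refine h.trans (mul_le_mul_of_nonneg_right ?_ (Real.rpow_nonneg (hdhi _ _) _))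
    rw [hHdef]
    calc C₂ * s ^ (e - α') * Real.exp (-(δ₂ * s⁻¹ * min (dhi x z) (dhi y z)))
        ≤ C₂ * s ^ (e - α') * (Real.exp δ₂ * W) := mul_le_mul_of_nonneg_left hw3 (by positivity)
      _ = C₂ * Real.exp δ₂ * s ^ (e - α') * W := by ring
  have h4 : |Flo (pt x) (pt z) - Flo (pt y) (pt z)| ≤ H * b ^ α' := by
    have h := hHlo (pt x) (pt y) (pt z) hxy'
    rw [abs_holderDeriv_le_iff α' Flo hxy' (pt z)] at h
    refine h.trans (mul_le_mul_of_nonneg_right ?_ (Real.rpow_nonneg (hdlo _ _) _))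
    rw [hHdef]
    calc C₂ * s ^ (e - α') * Real.exp (-(δ₂ * s⁻¹ * m)) ≤ C₂ * s ^ (e - α') * W := mul_le_mul_of_nonneg_left hw2 (by positivity)
      _ ≤ C₂ * Real.exp δ₂ * s ^ (e - α') * W :=
          mul_le_mul_of_nonneg_right (mul_le_mul_of_nonneg_right hCH hse'.le) hW.le
  -- §1's interpolation lemma
  have key := twoSpacing_holderQuot_le hα hαα' hα'1 hxy hη hbη hab hR0 hH0 h1 h2 h3 h4
  rw [holderDeriv_def, holderDeriv_def]
  refine key.trans (le_of_eq ?_)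
  -- bookkeeping of the constants
  have hθβ : (1 - α / α') + α / α' = 1 := by ring
  have hαβ : α' * (α / α') = α := by field_simp
  rw [hRdef, hHdef, interpolated_letter_eq hC₁ (by positivity) hs hρ hW hθβ hαβ, defect_letter_eq hs hη]
  ring

end Generic

end Summit.QuantumFields.YangMills.BalabanUVNodes.N15KingModelRung.Curved

end
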